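import Summits.CriticalPhenomena.PercolationContinuityZ3.Theorems.PercNearOneGluingNoHeavyLowerTailAntitheticUpsetDiag
import HarnessLib

/-!
# `NoHeavyLowerTail` (stmt-CriticalPhenomena-4575) — antithetic cluster pairs: **THE UP-SET LEMMA IN ABSTRACT FORM** (any red-dominated cube;
# prim-hp-2 gen 73, HOME/THEOREM-TW.md §5)

Support file (`--supports stmt-CriticalPhenomena-4575`, hull-port prover `prim-hp-2`, gen 73).  No definitions, no named facts, no sorries;
standard axioms.  …AntitheticUpsetDiag proved THEOREM U on the full colouring cube of a rooted graph.  Its proof uses only: the cube `Set ι`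
with counting measure, set-valued maps `X` increasing and `Y` decreasing, ANTIPODAL DOMINATION `Y ωᶜ ⊆ X ω`, an anchor `A₀ ⊆ X ω`, and an
increasing event `𝒰`.  This file records that abstract form,
* `Antithetic.Upset.abstract_upset_diag_sum_nonneg` —
  `0 ≤ Σ_{ω ∈ 𝒰} [ (F⁺(X ω) − F⁻(Y ω))(G⁺(X ω) − G⁻(Y ω)) + (F⁺(X ω) − F⁺A₀)(G⁺(X ω) − G⁺A₀) ]`  for all monotone `F⁻ ≤ F⁺`, `G⁻ ≤ G⁺`,
so that it applies to SUB-CUBES of colourings (pairs fixed by a pattern, the free pairs forming `ι`) — e.g. the `ρ`-cube of the pairs of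
`H = G − s − P` at a twin pair with `X ρ = {s,P} ∪ R_ρ(N)`, `Y ρ = {s} ∪ B_ρ(K)` (HOME/THEOREM-TW.md §3ter: the PAIRING PRINCIPLE — a nested
type pattern pays for the diagonal of its partner; THEOREM TP).  With `𝒰 = ` everything and `A₀ = ∅`-anchor dropped this is the red-dominated
cube lemma `Antithetic.superodd_cube_sum_nonneg` restricted to the shifted class.
[cite: VandenbergHaggstromKahn2005, §1 p. 6 ("Harris' inequality")]
-/

noncomputable section

namespace Summit.CriticalPhenomena.PercolationContinuityZ3.Theorems

open Literature.Probability.Percolation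
open scoped Classical

namespace Antithetic

namespace Upset

variable {ι W : Type*} [Fintype ι]

/-- **THEOREM U, abstract form.**  `X` increasing, `Y` decreasing set-valued maps on the cube `Set ι` with `Y ωᶜ ⊆ X ω` and `A₀ ⊆ X ω` for all
`ω`; `𝒰` an increasing event; `F⁻ ≤ F⁺`, `G⁻ ≤ G⁺` monotone.  Then
`0 ≤ Σ_{ω ∈ 𝒰} [ (F⁺(X ω) − F⁻(Y ω))(G⁺(X ω) − G⁻(Y ω)) + (F⁺(X ω) − F⁺A₀)(G⁺(X ω) − G⁺A₀) ]`. [this work] -/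
theorem abstract_upset_diag_sum_nonneg (X Y : Set ι → Set W) (hXmono : Monotone X) (hYanti : Antitone Y)
    (hdom : ∀ ω, Y ωᶜ ⊆ X ω) (A₀ : Set W) (hsX : ∀ ω, A₀ ⊆ X ω)
    (U : Set ι → Prop) [DecidablePred U] (hU : ∀ ⦃ω ω' : Set ι⦄, ω ⊆ ω' → U ω → U ω')
    (Fp Fm Gp Gm : Set W → ℝ) (hFp : Monotone Fp) (hFm : Monotone Fm) (hF : ∀ S, Fm S ≤ Fp S)
    (hGp : Monotone Gp) (hGm : Monotone Gm) (hG : ∀ S, Gm S ≤ Gp S) :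
    0 ≤ ∑ T ∈ Finset.univ.filter U,
      ((Fp (X T) - Fm (Y T)) * (Gp (X T) - Gm (Y T)) + (Fp (X T) - Fp A₀) * (Gp (X T) - Gp A₀)) := by
  -- the indicator of the event and the six functions of a colouring
  let u : Set ι → ℝ := fun T => if U T then 1 else 0
  let A : Set ι → ℝ := fun T => Fp (X T) - Fp A₀
  let B : Set ι → ℝ := fun T => Gp (X T) - Gp A₀
  let f : Set ι → ℝ := fun T => Fm (Y T) - Fp A₀
  let g : Set ι → ℝ := fun T => Gm (Y T) - Gp A₀
  let fp : Set ι → ℝ := fun T => max (f T) 0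
  let fn : Set ι → ℝ := fun T => max (-f T) 0
  let gp : Set ι → ℝ := fun T => max (g T) 0
  let gn : Set ι → ℝ := fun T => max (-g T) 0
  have hu0 : ∀ T, 0 ≤ u T := fun T => by simp only [u]; split_ifs <;> norm_num
  have hu1 : ∀ T, u T ≤ 1 := fun T => by simp only [u]; split_ifs <;> norm_num
  have humono : Monotone u := by
    intro T T' h
    simp only [u]
    by_cases hT : U T
    · rw [if_pos hT, if_pos (hU h hT)]
    · rw [if_neg hT]; split_ifs <;> norm_num
  have hA0 : ∀ T, 0 ≤ A T := fun T => sub_nonneg.2 (hFp (hsX T))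
  have hB0 : ∀ T, 0 ≤ B T := fun T => sub_nonneg.2 (hGp (hsX T))
  have hAmono : Monotone A := fun T T' h => sub_le_sub_right (hFp (hXmono h)) _
  have hBmono : Monotone B := fun T T' h => sub_le_sub_right (hGp (hXmono h)) _
  have hfanti : Antitone f := fun T T' h => sub_le_sub_right (hFm (hYanti h)) _
  have hganti : Antitone g := fun T T' h => sub_le_sub_right (hGm (hYanti h)) _
  have hfp0 : ∀ T, 0 ≤ fp T := fun T => le_max_right _ _
  have hfn0 : ∀ T, 0 ≤ fn T := fun T => le_max_right _ _
  have hgp0 : ∀ T, 0 ≤ gp T := fun T => le_max_right _ _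
  have hgn0 : ∀ T, 0 ≤ gn T := fun T => le_max_right _ _
  have hfpanti : Antitone fp := fun T T' h => max_le_max (hfanti h) le_rfl
  have hgpanti : Antitone gp := fun T T' h => max_le_max (hganti h) le_rfl
  have hfnmono : Monotone fn := fun T T' h => max_le_max (neg_le_neg (hfanti h)) le_rfl
  have hgnmono : Monotone gn := fun T T' h => max_le_max (neg_le_neg (hganti h)) le_rfl
  have hf_eq : ∀ T, f T = fp T - fn T := fun T => by
    simp only [fp, fn]; rcases le_total (f T) 0 with h | h
    · rw [max_eq_right h, max_eq_left (neg_nonneg.2 h)]; ring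
    · rw [max_eq_left h, max_eq_right (neg_nonpos.2 h)]; ring
  have hg_eq : ∀ T, g T = gp T - gn T := fun T => by
    simp only [gp, gn]; rcases le_total (g T) 0 with h | h
    · rw [max_eq_right h, max_eq_left (neg_nonneg.2 h)]; ring
    · rw [max_eq_left h, max_eq_right (neg_nonpos.2 h)]; ring
  -- masses: Σ g₊(Y T) = Σ g₊(X T) ≤ Σ B, and the same for f
  have hmass_g : ∑ T, gp T ≤ ∑ T, B T := by
    rw [← Fintype.sum_equiv (Function.Involutive.toPerm (compl : Set ι → Set ι) compl_involutive) (fun T => gp Tᶜ) gp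
      (fun T => by simp)]
    refine Finset.sum_le_sum fun T _ => max_le ?_ (hB0 T)
    exact sub_le_sub_right ((hG _).trans (hGp (hdom T))) _
  have hmass_f : ∑ T, fp T ≤ ∑ T, A T := by
    rw [← Fintype.sum_equiv (Function.Involutive.toPerm (compl : Set ι → Set ι) compl_involutive) (fun T => fp Tᶜ) fp
      (fun T => by simp)]
    refine Finset.sum_le_sum fun T _ => max_le ?_ (hA0 T)
    exact sub_le_sub_right ((hF _).trans (hFp (hdom T))) _
  -- the four Harris inequalities
  have huA0 : ∀ T, 0 ≤ u T * A T := fun T => mul_nonneg (hu0 T) (hA0 T)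
  have huB0 : ∀ T, 0 ≤ u T * B T := fun T => mul_nonneg (hu0 T) (hB0 T)
  have hufn0 : ∀ T, 0 ≤ u T * fn T := fun T => mul_nonneg (hu0 T) (hfn0 T)
  have hugn0 : ∀ T, 0 ≤ u T * gn T := fun T => mul_nonneg (hu0 T) (hgn0 T)
  have huAmono : Monotone fun T => u T * A T := fun T T' h => mul_le_mul (humono h) (hAmono h) (hA0 T) (hu0 T')
  have huBmono : Monotone fun T => u T * B T := fun T T' h => mul_le_mul (humono h) (hBmono h) (hB0 T) (hu0 T')
  have hufnmono : Monotone fun T => u T * fn T := fun T T' h => mul_le_mul (humono h) (hfnmono h) (hfn0 T) (hu0 T')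
  have hugnmono : Monotone fun T => u T * gn T := fun T T' h => mul_le_mul (humono h) (hgnmono h) (hgn0 T) (hu0 T')
  have i1 : ∑ T, (u T * A T) * gp T ≤ ∑ T, (u T * A T) * B T := cross_le_same_le huA0 huAmono hB0 hBmono hgpanti hmass_g
  have i2 : ∑ T, (u T * B T) * fp T ≤ ∑ T, (u T * B T) * A T := cross_le_same_le huB0 huBmono hA0 hAmono hfpanti hmass_f
  have i3 : ∑ T, (u T * fn T) * gp T ≤ ∑ T, (u T * fn T) * B T := cross_le_same_le hufn0 hufnmono hB0 hBmono hgpanti hmass_g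
  have i4 : ∑ T, (u T * gn T) * fp T ≤ ∑ T, (u T * gn T) * A T := cross_le_same_le hugn0 hugnmono hA0 hAmono hfpanti hmass_f
  -- termwise identity and nonnegative remainder
  have hterm : ∀ T, u T * ((Fp (X T) - Fm (Y T)) * (Gp (X T) - Gm (Y T)) + (Fp (X T) - Fp A₀) * (Gp (X T) - Gp A₀)) =
      ((u T * A T) * B T - (u T * A T) * gp T) + ((u T * B T) * A T - (u T * B T) * fp T) +
      ((u T * gn T) * A T - (u T * gn T) * fp T) + ((u T * fn T) * B T - (u T * fn T) * gp T) +
      u T * (fp T * gp T + fn T * gn T) := by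
    intro T
    have e1 : Fp (X T) - Fm (Y T) = A T - f T := by simp only [A, f]; ring
    have e2 : Gp (X T) - Gm (Y T) = B T - g T := by simp only [B, g]; ring
    rw [e1, e2, hf_eq T, hg_eq T]
    ring
  have hrest : 0 ≤ ∑ T, u T * (fp T * gp T + fn T * gn T) :=
    Finset.sum_nonneg fun T _ => mul_nonneg (hu0 T) (add_nonneg (mul_nonneg (hfp0 T) (hgp0 T)) (mul_nonneg (hfn0 T) (hgn0 T)))
  -- rewrite the filtered sum as a weighted sum over all colourings
  rw [Finset.sum_filter]
  have hsum : ∑ T : Set ι, (if U T then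
        (Fp (X T) - Fm (Y T)) * (Gp (X T) - Gm (Y T)) + (Fp (X T) - Fp A₀) * (Gp (X T) - Gp A₀) else 0) =
      ∑ T : Set ι, u T * ((Fp (X T) - Fm (Y T)) * (Gp (X T) - Gm (Y T)) + (Fp (X T) - Fp A₀) * (Gp (X T) - Gp A₀)) := by
    refine Finset.sum_congr rfl fun T _ => ?_
    simp only [u]
    split_ifs <;> simp
  rw [hsum]
  simp_rw [hterm]
  rw [Finset.sum_add_distrib, Finset.sum_add_distrib, Finset.sum_add_distrib, Finset.sum_add_distrib,
    Finset.sum_sub_distrib, Finset.sum_sub_distrib, Finset.sum_sub_distrib, Finset.sum_sub_distrib]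
  linarith


end Upset

end Antithetic

end Summit.CriticalPhenomena.PercolationContinuityZ3.Theorems
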